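import Summits.CriticalPhenomena.Ising3DConformalLimit.Theorems.InverseSquareTelemetryTwoPointSpineComplementHalfEdge
import Summits.CriticalPhenomena.Ising3DConformalLimit.Theorems.InverseSquareTelemetryTwoPointSpineComplementAnatomy
import Summits.CriticalPhenomena.Ising3DConformalLimit.Theorems.InverseSquareTelemetryTwoPointSpineComplementCoulombCorner
import HarnessLib

/-!
# Crux `InverseSquareTelemetry.TwoPointSpineComplement` (stmt-CriticalPhenomena-4497), line `registered`, lead c3:
# skeleton v3 — the reshaped corner stub α″ = `NoCoulombLaw`, its payer edges, the composition and its exactness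

THEOREM-ONLY helper file (`--supports stmt-CriticalPhenomena-4497`; no definition, no named fact, no `sorry`), sibling of
`…HalfEdge.lean` (which proves that at `Δ = 1/2` every non-degenerate scale-covariant pointwise limit of `criticalCorr 3`
has `U₄ ≡ 0`, so that `(C)` forbids the exact Coulomb law: `noCoulombLaw_of_twoPointSpineComplement`).

Skeleton v3 of the line (registered 2026-08-17, `Cruxes/TwoPointSpineComplement/Lines/birth.lean`) replaces v2's corner stub
α′ `stub_coulombCorner` ("under the Coulomb law every non-degenerate Möbius(1/2) limit has `U₄ ≢ 0`" — a conclusion that is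
never true) by the bare two-point stub α″ `stub_noCoulombLaw` : `∀ c > 0, ¬ (⟨σ₀σ_x⟩⁺_{β_c(3)}·|x|₂^{2·(1/2)} → c)`. Here:

* `noCoulombLaw_of_dyadic_of_coulombCorner` — D₂ ⟹ I₂ ⟹ α′ ⟹ α″: the v2 stubs already imply α″ (the reshape loses nothing);
* payer edges of α″: `noCoulombLaw_of_nonSaturation` (item stmt-1342 `PerfectScreening.NonSaturation`; the registered
  bookkeeping stub of this file), `noCoulombLaw_of_etaPositive` (stmt-2600), `noCoulombLaw_of_limitExists_of_nonGaussian`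
  (stmt-4738 + stmt-0636), `noCoulombLaw_of_limitExists_of_coulombImpliesNontrivial` (stmt-4738 + stmt-13885);
* `TwoPointSpineComplement_of_noCoulombLaw` — the v3 composition `D₂ → I₂ → α″ → β → γ → (C)` (the corner `Δ = 1/2` is empty);
* `twoPointSpineComplement_iff_dyadic_noCoulomb_window` — EXACT residual of v3: `(C) ↔ D₂ ∧ I₂ ∧ α″ ∧ β′ ∧ γ′` (β′, γ′ the
  law-restricted window `1/2 < Δ < 3/4` and corner `Δ = 3/4`), composing `…Anatomy.twoPointSpineComplement_iff_dyadic_and_regimes`,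
  `…Anatomy.regimes_iff_window_split` and `…HalfEdge.noCoulombLaw_of_twoPointSpineComplement`.

References: Duminil-Copin, ICM 2022, §8.4; Aizenman, Comm. Math. Phys. 86 (1982) §1; Pohlmeyer, Comm. Math. Phys. 12 (1969).
-/

noncomputable section

namespace Summit.CriticalPhenomena.Ising3DConformalLimit.InverseSquareTelemetryTwoPointSpineComplement.HalfEdge

open Literature.Probability.LatticeModels Filter Topology EuclideanGeometry
open Summit.CriticalPhenomena.Ising3DConformalLimit.Theses
open Summit.CriticalPhenomena.Ising3DConformalLimit.Theses.InverseSquareTelemetry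
  (TwoPointSpineComplement IsingEuclidUpgradeR2RotInvPowerLaw)
open Summit.CriticalPhenomena.Ising3DConformalLimit.Theses.PrecisionLaplacian
  (MoebiusLimitOfTwoPointLaw IsingEuclidUpgradeR4NonGaussian)
open Summit.CriticalPhenomena.Ising3DConformalLimit.PrecisionLaplacianMoebiusLimitOfTwoPointLaw
  (moebiusLimitOfTwoPointLaw_of_dyadic)
open Summit.CriticalPhenomena.Ising3DConformalLimit.InverseSquareTelemetryTwoPointSpineComplement.Anatomy
  (twoPointSpineComplement_iff_dyadic_and_regimes regimes_iff_window_split)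
open Summit.CriticalPhenomena.Ising3DConformalLimit.InverseSquareTelemetryTwoPointSpineComplement.CoulombCorner
  (not_nonSaturation_of_coulombLaw coulombLower_of_coulombLaw)
open Summit.CriticalPhenomena.Ising3DConformalLimit.GaussianLimitNotScreenedNegative (dimension_window_and_eta)

/-! ### The v2 corner stub implies the v3 one -/

/-- **D₂ ⟹ I₂ ⟹ α′ ⟹ α″: the registered stubs of skeleton v2 already imply `NoCoulombLaw`.** Under the Coulomb
law, D₂ + I₂ give (item 4801, `moebiusLimitOfTwoPointLaw_of_dyadic`) a non-degenerate Möbius-covariant limit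
`(ρ, Δ', S)`; rigidity pins `Δ' = 1/2` (`scalingDimension_eq_of_twoPointLaw`); α′ makes it non-Gaussian, which
`not_hasNontrivialU4_of_moebius_half` forbids. So replacing α′ by α″ in the skeleton loses nothing. [folklore] -/
theorem noCoulombLaw_of_dyadic_of_coulombCorner
    (hD : ∀ Δ c : ℝ, 0 < c →
      Tendsto (fun x : Site 3 =>
        criticalTwoPoint 3 x * Real.sqrt (∑ i, ((x i : ℝ)) ^ 2) ^ (2 * Δ)) cofinite (nhds c) →
      ∀ n, 4 ≤ n → Even n → ∃ Tn : (Fin n → EuclideanSpace ℝ (Fin 3)) → ℝ,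
        TendstoLocallyUniformlyOn
          (fun k : ℕ => rescaledCorrelator (criticalCorr 3) (fun δ => δ ^ (-Δ)) n (((2:ℝ) ^ k)⁻¹))
          Tn atTop (NonCoincident 3 n))
    (hI : ∀ Δ c : ℝ, 0 < c →
      Tendsto (fun x : Site 3 =>
        criticalTwoPoint 3 x * Real.sqrt (∑ i, ((x i : ℝ)) ^ 2) ^ (2 * Δ)) cofinite (nhds c) →
      ∀ n, 4 ≤ n → Even n → ∀ Tn : (Fin n → EuclideanSpace ℝ (Fin 3)) → ℝ,
        TendstoLocallyUniformlyOn
          (fun k : ℕ => rescaledCorrelator (criticalCorr 3) (fun δ => δ ^ (-Δ)) n (((2:ℝ) ^ k)⁻¹))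
          Tn atTop (NonCoincident 3 n) →
        ∀ x ∈ NonCoincident 3 n, (∀ i, x i ≠ 0) →
          Tn (fun i => inversion 0 1 (x i)) = (∏ i, ‖x i‖ ^ (2 * Δ)) * Tn x)
    (hα : ∀ c : ℝ, 0 < c →
      Tendsto (fun x : Site 3 =>
        criticalTwoPoint 3 x * Real.sqrt (∑ i, ((x i : ℝ)) ^ 2) ^ (2 * (1 / 2 : ℝ))) cofinite (nhds c) →
      ∀ (ρ : ℝ → ℝ) (S : CorrFamily 3), (∀ δ ∈ Set.Ioc (0:ℝ) 1, 0 < ρ δ) →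
        HasPointwiseScalingLimit (criticalCorr 3) ρ S → IsNondegenerateTwoPoint S →
        IsMoebiusCovariant (1 / 2) S → HasNontrivialU4 S) :
    ∀ c : ℝ, 0 < c → ¬ Tendsto (fun x : Site 3 =>
      criticalTwoPoint 3 x * Real.sqrt (∑ i, ((x i : ℝ)) ^ 2) ^ (2 * (1 / 2 : ℝ))) cofinite (nhds c) := by
  intro c hc hP
  obtain ⟨ρ, Δ', S, hρ, -, hlim, hnd, hm⟩ := moebiusLimitOfTwoPointLaw_of_dyadic hD hI ⟨1 / 2, c, hc, hP⟩
  have hEq : Δ' = 1 / 2 := scalingDimension_eq_of_twoPointLaw hc hP hlim hm.isScaleCovariant hnd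
  subst hEq
  exact not_hasNontrivialU4_of_moebius_half hρ hlim hnd hm (hα c hc hP ρ S hρ hlim hnd hm)

/-! ### Payer edges of the reshaped corner stub α″ = `NoCoulombLaw` -/

/-- **Edge 1342 ⟹ α″ (registered bookkeeping stub of this `--supports` file; header on one line).**
`PerfectScreening.NonSaturation` (item stmt-1342, `liminf n⟨σ₀σ_{ne₁}⟩ = 0`, the weakest avatar of `η(3) > 0`) refutes
the Coulomb law (`not_nonSaturation_of_coulombLaw`). [folklore] -/
theorem noCoulombLaw_of_nonSaturation : Summit.CriticalPhenomena.Ising3DConformalLimit.Theses.PerfectScreening.NonSaturation → ∀ c : ℝ, 0 < c → ¬ Filter.Tendsto (fun x : Literature.Probability.LatticeModels.Site 3 => Literature.Probability.LatticeModels.criticalTwoPoint 3 x * Real.sqrt (∑ i, ((x i : ℝ)) ^ 2) ^ (2 * (1 / 2 : ℝ))) Filter.cofinite (nhds c) :=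
  fun h1342 _c hc hP => not_nonSaturation_of_coulombLaw hc hP h1342

/-- **Edge 2600 ⟹ α″.** `AnomalousForcesInteraction.EtaPositive` (item stmt-2600) implies `NonSaturation`
(`nonSaturation_of_etaPositive`), hence α″ — the physically expected branch. [folklore] -/
theorem noCoulombLaw_of_etaPositive (h2600 : AnomalousForcesInteraction.EtaPositive) :
    ∀ c : ℝ, 0 < c → ¬ Tendsto (fun x : Site 3 =>
      criticalTwoPoint 3 x * Real.sqrt (∑ i, ((x i : ℝ)) ^ 2) ^ (2 * (1 / 2 : ℝ))) cofinite (nhds c) :=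
  noCoulombLaw_of_nonSaturation (Theorems.nonSaturation_of_etaPositive h2600)

/-- **Edge 4738 + 0636 ⟹ α″.** Bare existence plus non-Gaussianity of all limits exclude the Coulomb law
(`coulombLaw_limitExists_nonGaussian_false`). [folklore] -/
theorem noCoulombLaw_of_limitExists_of_nonGaussian (hL : WeylWindow.LimitExists)
    (hN : IsingEuclidUpgradeR4NonGaussian) :
    ∀ c : ℝ, 0 < c → ¬ Tendsto (fun x : Site 3 =>
      criticalTwoPoint 3 x * Real.sqrt (∑ i, ((x i : ℝ)) ^ 2) ^ (2 * (1 / 2 : ℝ))) cofinite (nhds c) :=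
  fun _c hc hP => coulombLaw_limitExists_nonGaussian_false hc hP hL hN

/-- **Edge 4738 + 13885 ⟹ α″.** Under the Coulomb law the Coulomb LOWER bound holds
(`coulombLower_of_coulombLaw`), so `PerfectScreening.CoulombImpliesNontrivial` (item stmt-13885) makes every
non-degenerate limit non-Gaussian while `not_hasNontrivialU4_of_coulombLaw` makes it Gaussian; with one limit in hand
(item 4738) this is absurd. [folklore] -/
theorem noCoulombLaw_of_limitExists_of_coulombImpliesNontrivial (hL : WeylWindow.LimitExists)
    (h13885 : PerfectScreening.CoulombImpliesNontrivial) :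
    ∀ c : ℝ, 0 < c → ¬ Tendsto (fun x : Site 3 =>
      criticalTwoPoint 3 x * Real.sqrt (∑ i, ((x i : ℝ)) ^ 2) ^ (2 * (1 / 2 : ℝ))) cofinite (nhds c) := by
  intro c hc hP
  obtain ⟨ρ, S, hρ, hlim, hnd⟩ := hL
  exact not_hasNontrivialU4_of_coulombLaw hc hP hρ hlim hnd
    (h13885 (coulombLower_of_coulombLaw hc hP) ρ S hρ hlim hnd)

/-! ### Skeleton v3: the composition with α″ in place of α′, and its exactness -/

/-- **Composition of skeleton v3: `D₂ → I₂ → α″ → β → γ → (C)`.** As in v2 (`moebiusLimitOfTwoPointLaw_of_dyadic`,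
rigidity, `dimension_window_and_eta`), except that the Coulomb corner `Δ = 1/2` is now EMPTY: α″ contradicts the law
hypothesis there. [folklore] -/
theorem TwoPointSpineComplement_of_noCoulombLaw
    (hD : ∀ Δ c : ℝ, 0 < c →
      Tendsto (fun x : Site 3 =>
        criticalTwoPoint 3 x * Real.sqrt (∑ i, ((x i : ℝ)) ^ 2) ^ (2 * Δ)) cofinite (nhds c) →
      ∀ n, 4 ≤ n → Even n → ∃ Tn : (Fin n → EuclideanSpace ℝ (Fin 3)) → ℝ,
        TendstoLocallyUniformlyOn
          (fun k : ℕ => rescaledCorrelator (criticalCorr 3) (fun δ => δ ^ (-Δ)) n (((2:ℝ) ^ k)⁻¹))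
          Tn atTop (NonCoincident 3 n))
    (hI : ∀ Δ c : ℝ, 0 < c →
      Tendsto (fun x : Site 3 =>
        criticalTwoPoint 3 x * Real.sqrt (∑ i, ((x i : ℝ)) ^ 2) ^ (2 * Δ)) cofinite (nhds c) →
      ∀ n, 4 ≤ n → Even n → ∀ Tn : (Fin n → EuclideanSpace ℝ (Fin 3)) → ℝ,
        TendstoLocallyUniformlyOn
          (fun k : ℕ => rescaledCorrelator (criticalCorr 3) (fun δ => δ ^ (-Δ)) n (((2:ℝ) ^ k)⁻¹))
          Tn atTop (NonCoincident 3 n) →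
        ∀ x ∈ NonCoincident 3 n, (∀ i, x i ≠ 0) →
          Tn (fun i => inversion 0 1 (x i)) = (∏ i, ‖x i‖ ^ (2 * Δ)) * Tn x)
    (hα : ∀ c : ℝ, 0 < c → ¬ Tendsto (fun x : Site 3 =>
      criticalTwoPoint 3 x * Real.sqrt (∑ i, ((x i : ℝ)) ^ 2) ^ (2 * (1 / 2 : ℝ))) cofinite (nhds c))
    (hβ : ∀ (ρ : ℝ → ℝ) (Δ : ℝ) (S : CorrFamily 3), (∀ δ ∈ Set.Ioc (0:ℝ) 1, 0 < ρ δ) →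
      HasPointwiseScalingLimit (criticalCorr 3) ρ S → IsNondegenerateTwoPoint S →
      IsMoebiusCovariant Δ S → 1 / 2 < Δ → Δ < 3 / 4 → HasNontrivialU4 S)
    (hγ : ∀ (ρ : ℝ → ℝ) (S : CorrFamily 3), (∀ δ ∈ Set.Ioc (0:ℝ) 1, 0 < ρ δ) →
      HasPointwiseScalingLimit (criticalCorr 3) ρ S → IsNondegenerateTwoPoint S →
      IsMoebiusCovariant (3 / 4) S → HasNontrivialU4 S) :
    TwoPointSpineComplement := by
  intro Δ c hc hP
  obtain ⟨ρ, Δ', S, hρ, hΔ', hlim, hnd, hmoeb⟩ := moebiusLimitOfTwoPointLaw_of_dyadic hD hI ⟨Δ, c, hc, hP⟩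
  have hEq : Δ' = Δ := scalingDimension_eq_of_twoPointLaw hc hP hlim hmoeb.isScaleCovariant hnd
  subst hEq
  refine ⟨ρ, S, hρ, hΔ', hlim, hnd, hmoeb, ?_⟩
  obtain ⟨⟨h₁, h₂⟩, -⟩ := dimension_window_and_eta hρ hlim hnd hmoeb.isScaleCovariant
  rcases h₁.eq_or_lt with h | h
  · -- the Coulomb corner is empty
    subst h
    exact absurd hP (hα c hc)
  rcases h₂.lt_or_eq with h' | h'
  · exact hβ ρ Δ' S hρ hlim hnd hmoeb h h'
  · subst h'
    exact hγ ρ S hρ hlim hnd hmoeb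

/-- **Exact residual of skeleton v3: `(C) ↔ D₂ ∧ I₂ ∧ α″ ∧ β′ ∧ γ′`** (β′, γ′ the law-restricted window and corner
`Δ = 3/4`). `→`: D₂, I₂, β′, γ′ by `twoPointSpineComplement_iff_dyadic_and_regimes` / `regimes_iff_window_split`, α″ by
`noCoulombLaw_of_twoPointSpineComplement`; `←`: the corner α′ of the v2 residual is vacuous under α″. [folklore] -/
theorem twoPointSpineComplement_iff_dyadic_noCoulomb_window :
    TwoPointSpineComplement ↔
      ((∀ Δ c : ℝ, 0 < c →
        Tendsto (fun x : Site 3 =>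
          criticalTwoPoint 3 x * Real.sqrt (∑ i, ((x i : ℝ)) ^ 2) ^ (2 * Δ)) cofinite (nhds c) →
        ∀ n, 4 ≤ n → Even n → ∃ Tn : (Fin n → EuclideanSpace ℝ (Fin 3)) → ℝ,
          TendstoLocallyUniformlyOn
            (fun k : ℕ => rescaledCorrelator (criticalCorr 3) (fun δ => δ ^ (-Δ)) n (((2:ℝ) ^ k)⁻¹))
            Tn atTop (NonCoincident 3 n)) ∧
      (∀ Δ c : ℝ, 0 < c →
        Tendsto (fun x : Site 3 =>
          criticalTwoPoint 3 x * Real.sqrt (∑ i, ((x i : ℝ)) ^ 2) ^ (2 * Δ)) cofinite (nhds c) →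
        ∀ n, 4 ≤ n → Even n → ∀ Tn : (Fin n → EuclideanSpace ℝ (Fin 3)) → ℝ,
          TendstoLocallyUniformlyOn
            (fun k : ℕ => rescaledCorrelator (criticalCorr 3) (fun δ => δ ^ (-Δ)) n (((2:ℝ) ^ k)⁻¹))
            Tn atTop (NonCoincident 3 n) →
          ∀ x ∈ NonCoincident 3 n, (∀ i, x i ≠ 0) →
            Tn (fun i => inversion 0 1 (x i)) = (∏ i, ‖x i‖ ^ (2 * Δ)) * Tn x) ∧
      (∀ c : ℝ, 0 < c → ¬ Tendsto (fun x : Site 3 =>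
        criticalTwoPoint 3 x * Real.sqrt (∑ i, ((x i : ℝ)) ^ 2) ^ (2 * (1 / 2 : ℝ))) cofinite (nhds c)) ∧
      (∀ Δ c : ℝ, 0 < c →
        Tendsto (fun x : Site 3 =>
          criticalTwoPoint 3 x * Real.sqrt (∑ i, ((x i : ℝ)) ^ 2) ^ (2 * Δ)) cofinite (nhds c) →
        1 / 2 < Δ → Δ < 3 / 4 →
        ∀ (ρ : ℝ → ℝ) (S : CorrFamily 3), (∀ δ ∈ Set.Ioc (0:ℝ) 1, 0 < ρ δ) →
          HasPointwiseScalingLimit (criticalCorr 3) ρ S → IsNondegenerateTwoPoint S →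
          IsMoebiusCovariant Δ S → HasNontrivialU4 S) ∧
      (∀ c : ℝ, 0 < c →
        Tendsto (fun x : Site 3 =>
          criticalTwoPoint 3 x * Real.sqrt (∑ i, ((x i : ℝ)) ^ 2) ^ (2 * (3 / 4 : ℝ))) cofinite (nhds c) →
        ∀ (ρ : ℝ → ℝ) (S : CorrFamily 3), (∀ δ ∈ Set.Ioc (0:ℝ) 1, 0 < ρ δ) →
          HasPointwiseScalingLimit (criticalCorr 3) ρ S → IsNondegenerateTwoPoint S →
          IsMoebiusCovariant (3 / 4) S → HasNontrivialU4 S)) := by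
  constructor
  · intro h
    obtain ⟨hD, hI, hN⟩ := twoPointSpineComplement_iff_dyadic_and_regimes.1 h
    obtain ⟨-, hβ, hγ⟩ := regimes_iff_window_split.1 hN
    exact ⟨hD, hI, noCoulombLaw_of_twoPointSpineComplement h, hβ, hγ⟩
  · rintro ⟨hD, hI, hα, hβ, hγ⟩
    refine twoPointSpineComplement_iff_dyadic_and_regimes.2 ⟨hD, hI, regimes_iff_window_split.2 ⟨?_, hβ, hγ⟩⟩
    exact fun c hc hP => absurd hP (hα c hc)

end Summit.CriticalPhenomena.Ising3DConformalLimit.InverseSquareTelemetryTwoPointSpineComplement.HalfEdge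

end
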